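import Summits.QuantumFields.YangMills.Theorems.BalabanUVNodesN15BackgroundVWordsNode
import Summits.QuantumFields.YangMills.Theorems.BalabanUVNodesN15VectorPieceV1Gauge
import Summits.QuantumFields.YangMills.Theorems.BalabanUVNodesN15DefectKernelAdjoint
import HarnessLib

/-!
# Route «BalabanUVNodes» (K4 «SpineRates»), node N15 = NE2 — THE (3.60) KNIT AT THE VECTOR PIECE: King's bond pairing has UNIFORM fibres (`(L^m)^{d+1}` fine bonds
# over each coarse bond), so the unit-block mean `Q` intertwines the two spacings EXACTLY and `T4EtaRate.NE2PlusOperator` holds BY NAME for the U = 1 vector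
# piece ⊗ 1_𝔤 dressed by the FULL perturbation `V′(A′) = V′₁(A′) − [F₂*aQ + Q*aF₂ + F₂*aF₂](A′)`, the gauge field `A′` the datum, for ANY averaging-perturbation
# species `F₂(A′)`, `F₂*(A′)` with the (3.59)-shape sup letter and a two-spacing fit letter — every U ≡ 1 input and the `Q`-intertwining a tree theorem

Cell `pub-ymgap`, seat `pub-ymgap-dag-n15-c` (generation g4; R134 ACCELERATION SEAT, strategy s1; HUMAN RULING D-0062; chair R424 venue; `bears_on: R4∕N15`).
Filed `--supports stmt-QuantumFields-19908 --as helper` (K3′; helper).  Imports BY NAME, nothing in the tree modified: this seat's `…N15BackgroundVWordsNode`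
(**`ne2PlusOperator_vWG`**, `vWGFamily4`; through it (V5) `avgWord`, `hasMaj_avgWord`, `hasMaj_idef_avgWord`, `fibAvg`), (V4) `…N15VectorPieceV1Gauge`
(`fibre_conn_kingPrV`, `bshiftEquiv_comm`, `v1GVecInstance`, `bshiftEquiv`; W4 `uniform_layer_v1M`; n15-a `pieceG`∕`pieceS`∕`pieceD3`∕`tensorId`∕`thetaV`∕`VecIndexS`∕
`blkFine`∕`kingPrV`∕`kingPr_val`∕`unitTorusGeoS`∕`inv_pow_le_rpow`; W1 `dPieces`∕`mPieces`), n15-a part 12 `…N15DefectKernelAdjoint` (`card_fibre_kingProj`), part 15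
`card_fibre_bondPair`, b06 `B6UnitTorusCarrier`, `King1986.Torus.blockOf`.

THE POINT.  (V5) typed the averaging words of [Balaban1985BackgroundPropagators] (3.60) p. 402 with the block mean `Q` CONCRETE and proved that their two-spacing
defect is carried by the `F₂`-letters alone WHEN the pairing has uniform fibres; `…VWordsNode` read `NE2PlusOperator` out by name for any block-local species.
THIS FILE closes the circle at the realised vector piece: §1 the unit-BOND blocking `qbond (x, μ) = (B(x), μ)` of the fine bonds (nested in King's unit blocks
`blkFine` by `rfl`), lifted to the product carrier, and the fibre count of King's bond pairing lifted to the product carrier — `(L^m)^{d+1}`, uniform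
(`card_fibre_kingPrV_lift`); §2 the word species `vecWordC`∕`vecWordF` = (V5)'s `avgWord` over `qbond` (coarse) ∕ `qbond ∘ kingPrV` (fine) with the constant
(3.24) weight `a` and ANY species `F₂(A′) : (bonds → ℝ^ι) → (unit bonds → ℝ^ι)`, `F₂*(A′)` back; **`vecWord_letters`**: the species letters of `…VWordsNode`
(`c_W = |a|·c_F·(2 + c_F)`) FROM the six `F₂`-letters (sup `≤ diagK (c_F·c₃₅Mα₀)` for `F₂, F₂*` at both spacings; fits `𝔇(F₂′, F₂), 𝔇(F₂*′, F₂*) ≤ diagK (c_F·c₃₅Mα₀·θ_j)`)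
in the smallness regime `2c₃₅Mα₀ ≤ 1`, by `hasMaj_avgWord`∕`hasMaj_idef_avgWord` and §1; §3 **`ne2PlusOperator_vectorPiece_vWordsG`**: `NE2PlusOperator c₃₅` for
`v1GVecInstance` with the families `vWGVecFamily4` (the -a pieces ⊗ 1_𝔤, forward and backward, dressed by `V′₁(A′) − words(A′)`), `d + 1 ≥ 2`, `L ≥ 1`, every
`c₃₅ > 0`, every weight `a`, every species with the six letters; `_dim4`; `ne2ZeroOperator_vectorPiece_vWordsG` (the trivial gauge field is C²-regular; species
letters asked at `c₃₅ = 1`).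

HONEST FRAMING ∕ LIMITS.  A knit plus one counting lemma.  The species `F₂(A′)`, `F₂*(A′)` and their six letters are DISPLAYED hypotheses (the print's `F′₂ⱼ(A)` of
(3.55)–(3.58) — products of parallel transports along contours — is NOT constructed here; its one-spacing bound (3.58) lives in the Literature cell's
`B9Eq358KeyEstimate` on a different carrier; the fit letter is NOT PRINTED); `Q` is the plain unit-block mean of bond functions componentwise (U ≡ 1 reading of
(3.19)), NOT the (1.18) line average; (3.35) = OUR unit-scale C² letters; transport = fibrewise mean (linearised (C3)); LINEAR (U = 1) vector piece; NOT NODE 00's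
carriers.  NE2⁺ NOT PRINTED; count-neutral (typed 28∕28 · discharged unchanged); NOT a discharge of N15; one finite T⁴ at fixed ε — NOT infinite volume, NOT OS on
ℝ⁴, NOT a mass gap, NOT Clay.
-/

noncomputable section

open scoped BigOperators
open Finset

namespace Summit.QuantumFields.YangMills.BalabanUVNodes.N15.VectorPiece

open Literature.MathematicalPhysics.QuantumFieldTheory.Balaban1983to89
open Literature.MathematicalPhysics.QuantumFieldTheory.Balaban1983to89.B11SectG (BlockNorm HasMaj RowSum)
open Literature.MathematicalPhysics.QuantumFieldTheory.Balaban1983to89.B6RandomWalk (Triangle254)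
open Literature.MathematicalPhysics.QuantumFieldTheory.Balaban1983to89.T4EtaRate (PairedInstance NE2PlusOperator NE2ZeroOperator ne2Zero_of_ne2Plus)
open Literature.MathematicalPhysics.QuantumFieldTheory.Balaban1983to89.T4EtaRateDefect (idef rateWeight)
open Literature.MathematicalPhysics.QuantumFieldTheory.Balaban1983to89.T4EtaRateCoeffDefect (pull diagK diagK_mono fibre mem_fibre)
open Literature.MathematicalPhysics.QuantumFieldTheory.Balaban1983to89.B5Prop11Plancherel (Tor fine)
open Literature.MathematicalPhysics.QuantumFieldTheory.Balaban1983to89.B6UnitTorusCarrier (unitTorusGeo unitTorusGeo_len triangle254_unitTorusGeo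
  rowSum_unitTorusGeo)
open Literature.MathematicalPhysics.QuantumFieldTheory.King1986.Torus (blockOf tdistT tdistT_nonneg)
open Summit.QuantumFields.YangMills.BalabanUVNodes.N15.MatrixSpecies (liftMap liftBlk)
open Summit.QuantumFields.YangMills.BalabanUVNodes.N15.DefectKernel (card_fibre_kingProj card_fibre_bondPair)
open Summit.QuantumFields.YangMills.BalabanUVNodes.N15.BackgroundLayer (avgWord hasMaj_avgWord hasMaj_idef_avgWord vWGFamily4 ne2PlusOperator_vWG)

variable {d : ℕ}

/-! ## §1 The unit-bond blocking of the fine bonds and the uniform fibres of King's bond pairing, on the product carrier -/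

section Blocks

variable (L k m : ℕ) [NeZero L] (M : Fin (d + 1) → ℕ) [∀ μ, NeZero (M μ)] (ι : Type) [Fintype ι] [DecidableEq ι]

/-- THE UNIT-BOND BLOCKING of the fine bonds: `(x, μ) ↦ (B(x), μ)` — the unit bond with the base point's King block and the same direction (the averaging blocks of
the componentwise block mean `Q`). [cite: Balaban1985BackgroundPropagators, (3.19) p.393 (the averaging blocks: shape)] -/
def qbond (i : Tor (fine (L ^ k) M) × Fin (d + 1)) : Tor M × Fin (d + 1) := (blockOf (L ^ k) M i.1, i.2)

omit [Fintype ι] [DecidableEq ι] in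
/-- The averaging blocks NEST in the majorant blocks: `blkFine = fst ∘ qbond` (on the product carrier: `liftBlk blkFine ι = liftBlk fst ι ∘ liftMap qbond ι`), by `rfl`. [folklore] -/
theorem liftBlk_blkFine_eq (p : (Tor (fine (L ^ k) M) × Fin (d + 1)) × ι) :
    liftBlk (blkFine L k M) ι p = liftBlk (fun b : Tor M × Fin (d + 1) => b.1) ι (liftMap (qbond L k M) ι p) := rfl

/-- **KING's BOND PAIRING LIFTED TO THE PRODUCT CARRIER HAS UNIFORM FIBRES**: over every `(x, μ, i)` lie exactly `(L^m)^{d+1}` fine triples `(x′, μ, i)`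
(`card_fibre_bondPair` twice, `card_fibre_kingProj`). [cite: King1986, p.664 (pairing convention «x′ ∈ B^n(x)»)] -/
theorem card_fibre_kingPrV_lift (p : (Tor (fine (L ^ k) M) × Fin (d + 1)) × ι) :
    (fibre (liftMap (kingPrV L k m M) ι) p).card = (L ^ m) ^ (d + 1) := by
  obtain ⟨⟨x, μ⟩, i⟩ := p
  rw [card_fibre_bondPair (kingPrV L k m M) (liftMap (kingPrV L k m M) ι) (fun _ => rfl) (x, μ) i,
    card_fibre_bondPair (kingPr L k m M) (kingPrV L k m M) (fun _ => rfl) x μ]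
  exact card_fibre_kingProj L k m M (kingPr L k m M) (kingPr_val L k m M) x

end Blocks

/-! ## §2 The word species at the vector piece and its letters from the `F₂`-letters -/

section Species

variable {𝔄 : Type} (ι : Type) [Fintype ι] [DecidableEq ι] (L : ℕ) [NeZero L] (a : ℝ)

/-- THE COARSE WORD at index `j` and gauge field `A′`: (V5)'s `avgWord` over the unit-bond blocking of the COARSE bonds (lifted to the product carrier), weight the
constant `a`, species `F₂(A′)`, `F₂*(A′)`. [cite: Balaban1985BackgroundPropagators, (3.60) p.402 (shape)] -/
def vecWordC (j : VecIndexS d L)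
    (Fc : (Fin (d + 1) → Tor (fine (L ^ j.m * L ^ j.k) j.Mn) × Fin (d + 1) → 𝔄) →
      (((Tor (fine (L ^ j.k) j.Mn) × Fin (d + 1)) × ι → ℝ) →ₗ[ℝ] ((Tor j.Mn × Fin (d + 1)) × ι → ℝ)))
    (Fsc : (Fin (d + 1) → Tor (fine (L ^ j.m * L ^ j.k) j.Mn) × Fin (d + 1) → 𝔄) →
      (((Tor j.Mn × Fin (d + 1)) × ι → ℝ) →ₗ[ℝ] ((Tor (fine (L ^ j.k) j.Mn) × Fin (d + 1)) × ι → ℝ)))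
    (A' : Fin (d + 1) → Tor (fine (L ^ j.m * L ^ j.k) j.Mn) × Fin (d + 1) → 𝔄) :
    ((Tor (fine (L ^ j.k) j.Mn) × Fin (d + 1)) × ι → ℝ) →ₗ[ℝ] ((Tor (fine (L ^ j.k) j.Mn) × Fin (d + 1)) × ι → ℝ) :=
  avgWord (liftMap (qbond L j.k j.Mn) ι) (fun _ => a) (Fc A') (Fsc A')

/-- THE FINE WORD at index `j` and gauge field `A′`: `avgWord` over the blocking `qbond ∘ kingPrV` of the FINE bonds (the fine bonds' own unit-bond blocking, written
through the pairing so that (V5)'s intertwining applies verbatim), weight `a`, species `F₂′(A′)`, `F₂*′(A′)`. [cite: Balaban1985BackgroundPropagators, (3.60) p.402 (shape)] -/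
def vecWordF (j : VecIndexS d L)
    (Ff : (Fin (d + 1) → Tor (fine (L ^ j.m * L ^ j.k) j.Mn) × Fin (d + 1) → 𝔄) →
      (((Tor (fine (L ^ j.m * L ^ j.k) j.Mn) × Fin (d + 1)) × ι → ℝ) →ₗ[ℝ] ((Tor j.Mn × Fin (d + 1)) × ι → ℝ)))
    (Fsf : (Fin (d + 1) → Tor (fine (L ^ j.m * L ^ j.k) j.Mn) × Fin (d + 1) → 𝔄) →
      (((Tor j.Mn × Fin (d + 1)) × ι → ℝ) →ₗ[ℝ] ((Tor (fine (L ^ j.m * L ^ j.k) j.Mn) × Fin (d + 1)) × ι → ℝ)))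
    (A' : Fin (d + 1) → Tor (fine (L ^ j.m * L ^ j.k) j.Mn) × Fin (d + 1) → 𝔄) :
    ((Tor (fine (L ^ j.m * L ^ j.k) j.Mn) × Fin (d + 1)) × ι → ℝ) →ₗ[ℝ] ((Tor (fine (L ^ j.m * L ^ j.k) j.Mn) × Fin (d + 1)) × ι → ℝ) :=
  avgWord (liftMap (qbond L j.k j.Mn) ι ∘ liftMap (kingPrV L j.k j.m j.Mn) ι) (fun _ => a) (Ff A') (Fsf A')

/-- **THE SPECIES LETTERS OF THE WORDS FROM THE SIX `F₂`-LETTERS.**  At index `j`, gauge field `A′`, in the smallness regime `2c₃₅Mα₀ ≤ 1` (`c₃₅ > 0`, `M ≥ 1`, `α₀ > 0`,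
`c_F ≥ 0`): sup letters `F₂, F₂*, F₂′, F₂*′ ≤ diagK (c_F·c₃₅Mα₀)` and fit letters `𝔇(F₂′, F₂) ≤ diagK (c_F·c₃₅Mα₀·θ_j)` (through `(pull π, 1)`), `𝔇(F₂*′, F₂*) ≤ diagK (c_F·c₃₅Mα₀·θ_j)`
(through `(1, pull π)`) give the word letters of `…VWordsNode` with `c_W = |a|·c_F·(2 + c_F)`: `W, W′ ≤ diagK (c_W·c₃₅Mα₀)`, `𝔇(W′, W) ≤ diagK (c_W·c₃₅Mα₀·θ_j)` —
`hasMaj_avgWord`, `hasMaj_idef_avgWord` with §1's uniform fibres. [cite: Balaban1985BackgroundPropagators, (3.59)–(3.61) p.402 (shapes); (3.63)–(3.65) pp.402–403 (mechanism)] -/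
theorem vecWord_letters (j : VecIndexS d L) {c35 α₀ cF : ℝ} (hc35 : 0 < c35) (hα₀ : 0 < α₀) (hcF : 0 ≤ cF) (hsm : 2 * (c35 * (j.Msz * α₀)) ≤ 1)
    {Fc : ((Tor (fine (L ^ j.k) j.Mn) × Fin (d + 1)) × ι → ℝ) →ₗ[ℝ] ((Tor j.Mn × Fin (d + 1)) × ι → ℝ)}
    {Fsc : ((Tor j.Mn × Fin (d + 1)) × ι → ℝ) →ₗ[ℝ] ((Tor (fine (L ^ j.k) j.Mn) × Fin (d + 1)) × ι → ℝ)}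
    {Ff : ((Tor (fine (L ^ j.m * L ^ j.k) j.Mn) × Fin (d + 1)) × ι → ℝ) →ₗ[ℝ] ((Tor j.Mn × Fin (d + 1)) × ι → ℝ)}
    {Fsf : ((Tor j.Mn × Fin (d + 1)) × ι → ℝ) →ₗ[ℝ] ((Tor (fine (L ^ j.m * L ^ j.k) j.Mn) × Fin (d + 1)) × ι → ℝ)}
    (hF : HasMaj (BlockNorm.ofBlocks (unitTorusGeoS L j.k j.Mn j.Msz) (liftBlk (blkFine L j.k j.Mn) ι))
      (BlockNorm.ofBlocks (unitTorusGeoS L j.k j.Mn j.Msz) (liftBlk (fun b : Tor j.Mn × Fin (d + 1) => b.1) ι)) Fc (diagK fun _ => cF * (c35 * j.Msz * α₀)))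
    (hFs : HasMaj (BlockNorm.ofBlocks (unitTorusGeoS L j.k j.Mn j.Msz) (liftBlk (fun b : Tor j.Mn × Fin (d + 1) => b.1) ι))
      (BlockNorm.ofBlocks (unitTorusGeoS L j.k j.Mn j.Msz) (liftBlk (blkFine L j.k j.Mn) ι)) Fsc (diagK fun _ => cF * (c35 * j.Msz * α₀)))
    (hF' : HasMaj (BlockNorm.ofBlocks (unitTorusGeoS L j.k j.Mn j.Msz) (liftBlk (blkFine L j.k j.Mn ∘ kingPrV L j.k j.m j.Mn) ι))
      (BlockNorm.ofBlocks (unitTorusGeoS L j.k j.Mn j.Msz) (liftBlk (fun b : Tor j.Mn × Fin (d + 1) => b.1) ι)) Ff (diagK fun _ => cF * (c35 * j.Msz * α₀)))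
    (hFs' : HasMaj (BlockNorm.ofBlocks (unitTorusGeoS L j.k j.Mn j.Msz) (liftBlk (fun b : Tor j.Mn × Fin (d + 1) => b.1) ι))
      (BlockNorm.ofBlocks (unitTorusGeoS L j.k j.Mn j.Msz) (liftBlk (blkFine L j.k j.Mn ∘ kingPrV L j.k j.m j.Mn) ι)) Fsf
      (diagK fun _ => cF * (c35 * j.Msz * α₀)))
    (hDF : HasMaj (BlockNorm.ofBlocks (unitTorusGeoS L j.k j.Mn j.Msz) (liftBlk (blkFine L j.k j.Mn) ι))
      (BlockNorm.ofBlocks (unitTorusGeoS L j.k j.Mn j.Msz) (liftBlk (fun b : Tor j.Mn × Fin (d + 1) => b.1) ι))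
      (idef (pull (liftMap (kingPrV L j.k j.m j.Mn) ι)) LinearMap.id Ff Fc) (diagK fun _ => cF * (c35 * j.Msz * α₀) * thetaV L j))
    (hDFs : HasMaj (BlockNorm.ofBlocks (unitTorusGeoS L j.k j.Mn j.Msz) (liftBlk (fun b : Tor j.Mn × Fin (d + 1) => b.1) ι))
      (BlockNorm.ofBlocks (unitTorusGeoS L j.k j.Mn j.Msz) (liftBlk (blkFine L j.k j.Mn ∘ kingPrV L j.k j.m j.Mn) ι))
      (idef LinearMap.id (pull (liftMap (kingPrV L j.k j.m j.Mn) ι)) Fsf Fsc) (diagK fun _ => cF * (c35 * j.Msz * α₀) * thetaV L j)) :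
    HasMaj (BlockNorm.ofBlocks (unitTorusGeoS L j.k j.Mn j.Msz) (liftBlk (blkFine L j.k j.Mn) ι))
        (BlockNorm.ofBlocks (unitTorusGeoS L j.k j.Mn j.Msz) (liftBlk (blkFine L j.k j.Mn) ι))
        (avgWord (liftMap (qbond L j.k j.Mn) ι) (fun _ => a) Fc Fsc) (diagK fun _ => |a| * cF * (2 + cF) * (c35 * j.Msz * α₀)) ∧
      HasMaj (BlockNorm.ofBlocks (unitTorusGeoS L j.k j.Mn j.Msz) (liftBlk (blkFine L j.k j.Mn ∘ kingPrV L j.k j.m j.Mn) ι))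
        (BlockNorm.ofBlocks (unitTorusGeoS L j.k j.Mn j.Msz) (liftBlk (blkFine L j.k j.Mn ∘ kingPrV L j.k j.m j.Mn) ι))
        (avgWord (liftMap (qbond L j.k j.Mn) ι ∘ liftMap (kingPrV L j.k j.m j.Mn) ι) (fun _ => a) Ff Fsf)
        (diagK fun _ => |a| * cF * (2 + cF) * (c35 * j.Msz * α₀)) ∧
      HasMaj (BlockNorm.ofBlocks (unitTorusGeoS L j.k j.Mn j.Msz) (liftBlk (blkFine L j.k j.Mn) ι))
        (BlockNorm.ofBlocks (unitTorusGeoS L j.k j.Mn j.Msz) (liftBlk (blkFine L j.k j.Mn ∘ kingPrV L j.k j.m j.Mn) ι))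
        (idef (pull (liftMap (kingPrV L j.k j.m j.Mn) ι)) (pull (liftMap (kingPrV L j.k j.m j.Mn) ι))
          (avgWord (liftMap (qbond L j.k j.Mn) ι ∘ liftMap (kingPrV L j.k j.m j.Mn) ι) (fun _ => a) Ff Fsf)
          (avgWord (liftMap (qbond L j.k j.Mn) ι) (fun _ => a) Fc Fsc))
        (diagK fun _ => |a| * cF * (2 + cF) * (c35 * j.Msz * α₀) * thetaV L j) := by
  set r : ℝ := cF * (c35 * j.Msz * α₀) with hr_def
  have hM0 : 0 ≤ j.Msz := zero_le_one.trans j.one_le_Msz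
  have hs0 : 0 ≤ c35 * j.Msz * α₀ := by positivity
  have hr0 : 0 ≤ r := mul_nonneg hcF hs0
  have hθ0 : 0 ≤ thetaV L j := by unfold thetaV; positivity
  have hro : 0 ≤ r * thetaV L j := mul_nonneg hr0 hθ0
  have hsmall : c35 * j.Msz * α₀ ≤ 1 / 2 := by nlinarith
  have hrle : r ≤ cF / 2 := by rw [hr_def]; nlinarith
  have hâ : 0 ≤ |a| := abs_nonneg a
  have haa : ∀ _b : (Tor j.Mn × Fin (d + 1)) × ι, |a| ≤ |a| := fun _ => le_rfl
  have hq : ∀ p : (Tor (fine (L ^ j.k) j.Mn) × Fin (d + 1)) × ι,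
      liftBlk (blkFine L j.k j.Mn) ι p = liftBlk (fun b : Tor j.Mn × Fin (d + 1) => b.1) ι (liftMap (qbond L j.k j.Mn) ι p) := fun _ => rfl
  -- the three word letters with (V5)'s constants
  have h1 := hasMaj_avgWord (g := unitTorusGeoS L j.k j.Mn j.Msz) (liftBlk (blkFine L j.k j.Mn) ι) (liftBlk (fun b : Tor j.Mn × Fin (d + 1) => b.1) ι)
    (liftMap (qbond L j.k j.Mn) ι) hq hâ hr0 haa hF hFs
  have h2 := hasMaj_avgWord (g := unitTorusGeoS L j.k j.Mn j.Msz) (liftBlk (blkFine L j.k j.Mn) ι ∘ liftMap (kingPrV L j.k j.m j.Mn) ι)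
    (liftBlk (fun b : Tor j.Mn × Fin (d + 1) => b.1) ι) (liftMap (qbond L j.k j.Mn) ι ∘ liftMap (kingPrV L j.k j.m j.Mn) ι) (fun p => hq _) hâ hr0 haa hF' hFs'
  have h3 := hasMaj_idef_avgWord (g := unitTorusGeoS L j.k j.Mn j.Msz) (liftMap (qbond L j.k j.Mn) ι) (liftMap (kingPrV L j.k j.m j.Mn) ι) (fun _ => a) Fc Fsc
    Ff Fsf (liftBlk (blkFine L j.k j.Mn) ι) (liftBlk (fun b : Tor j.Mn × Fin (d + 1) => b.1) ι) hq (pow_ne_zero _ (pow_ne_zero _ (NeZero.ne L)))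
    (card_fibre_kingPrV_lift L j.k j.m j.Mn ι) hâ hr0 hro haa hF hF' hFs' hDF hDFs
  -- the constants: `|a|·r·(2 + r) ≤ |a|c_F(2 + c_F)·s`, `|a|·rθ·(2 + 2r) ≤ |a|c_F(2 + c_F)·s·θ`
  have hc1 : |a| * r * (2 + r) ≤ |a| * cF * (2 + cF) * (c35 * j.Msz * α₀) := by
    have : r * (2 + r) ≤ cF * (2 + cF) * (c35 * j.Msz * α₀) := by
      rw [hr_def]; nlinarith [mul_nonneg hcF hs0, mul_nonneg (mul_nonneg hcF hcF) hs0]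
    nlinarith [mul_nonneg hâ (mul_nonneg hr0 (by linarith : (0:ℝ) ≤ 2 + r))]
  have hc2 : |a| * (r * thetaV L j) * (2 + 2 * r) ≤ |a| * cF * (2 + cF) * (c35 * j.Msz * α₀) * thetaV L j := by
    have : r * (2 + 2 * r) ≤ cF * (2 + cF) * (c35 * j.Msz * α₀) := by
      rw [hr_def]; nlinarith [mul_nonneg hcF hs0, mul_nonneg (mul_nonneg hcF hcF) hs0]
    have h' : |a| * (r * thetaV L j) * (2 + 2 * r) = |a| * thetaV L j * (r * (2 + 2 * r)) := by ring
    rw [h']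
    nlinarith [mul_nonneg (mul_nonneg hâ hθ0) (sub_nonneg.2 this)]
  exact ⟨h1.mono fun y y' => diagK_mono (fun _ => hc1) y y', h2.mono fun y y' => diagK_mono (fun _ => hc1) y y',
    h3.mono fun y y' => diagK_mono (fun _ => hc2) y y'⟩

end Species

/-! ## §3 The knit: `NE2PlusOperator` BY NAME with the full perturbation live at the vector piece ⊗ 1_𝔤 -/

section Knit

variable (𝔄 : Type) [NormedRing 𝔄] [NormedAlgebra ℝ 𝔄] [CompleteSpace 𝔄] (ι : Type) [Fintype ι] [DecidableEq ι] (e : 𝔄 ≃L[ℝ] (ι → ℝ)) (L : ℕ) [NeZero L]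
  (a : ℝ)

/-- THE REALISED KERNEL FAMILY WITH THE FULL PERTURBATION: `vWGFamily4` fed with the -a pieces ⊗ 1_𝔤 — `G`, `G∂_ν*`, `(Δ−∂∂*)G`, derived `dPieces` (forward AND backward),
mixed `mPieces` — at both spacings, entry-1 direction `inl j.ν`, and the word species `vecWordC`∕`vecWordF` of a given averaging-perturbation species.
[cite: Balaban1985BackgroundPropagators, (3.42) p.397, (3.44) p.398, (3.52) p.400, (3.60) p.402, (3.63)–(3.65) pp.402–403 (shapes, mechanism)] -/
def vWGVecFamily4 (hL : 1 ≤ L)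
    (Fc : ∀ j : VecIndexS d L, (Fin (d + 1) → Tor (fine (L ^ j.m * L ^ j.k) j.Mn) × Fin (d + 1) → 𝔄) →
      (((Tor (fine (L ^ j.k) j.Mn) × Fin (d + 1)) × ι → ℝ) →ₗ[ℝ] ((Tor j.Mn × Fin (d + 1)) × ι → ℝ)))
    (Fsc : ∀ j : VecIndexS d L, (Fin (d + 1) → Tor (fine (L ^ j.m * L ^ j.k) j.Mn) × Fin (d + 1) → 𝔄) →
      (((Tor j.Mn × Fin (d + 1)) × ι → ℝ) →ₗ[ℝ] ((Tor (fine (L ^ j.k) j.Mn) × Fin (d + 1)) × ι → ℝ)))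
    (Ff : ∀ j : VecIndexS d L, (Fin (d + 1) → Tor (fine (L ^ j.m * L ^ j.k) j.Mn) × Fin (d + 1) → 𝔄) →
      (((Tor (fine (L ^ j.m * L ^ j.k) j.Mn) × Fin (d + 1)) × ι → ℝ) →ₗ[ℝ] ((Tor j.Mn × Fin (d + 1)) × ι → ℝ)))
    (Fsf : ∀ j : VecIndexS d L, (Fin (d + 1) → Tor (fine (L ^ j.m * L ^ j.k) j.Mn) × Fin (d + 1) → 𝔄) →
      (((Tor j.Mn × Fin (d + 1)) × ι → ℝ) →ₗ[ℝ] ((Tor (fine (L ^ j.m * L ^ j.k) j.Mn) × Fin (d + 1)) × ι → ℝ)))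
    (j : VecIndexS d L) :
    B9.KernelFamily (v1GVecInstance (d := d) 𝔄 ι L hL j).gc (v1GVecInstance (d := d) 𝔄 ι L hL j).Bf :=
  vWGFamily4 e (g := unitTorusGeoS L j.k j.Mn j.Msz) (blkFine L j.k j.Mn) (kingPrV L j.k j.m j.Mn) (vecWordC ι L a j (Fc j) (Fsc j))
    (vecWordF ι L a j (Ff j) (Fsf j)) (bshiftEquiv j.Mn (L ^ j.k)) (bshiftEquiv j.Mn (L ^ j.m * L ^ j.k)) j.m (unitTorusGeoS_L_ne_zero L hL j) (Sum.inl j.ν)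
    (tensorId ι (pieceG L j.Mn (L ^ j.k) j.k (rweight (d := d) L j.k))) (tensorId ι (pieceS L j.Mn (L ^ j.k) j.k (rweight (d := d) L j.k) j.ν))
    (tensorId ι (pieceD3 L j.Mn (L ^ j.k) j.k (rweight (d := d) L j.k)))
    (fun μ => tensorId ι (dPieces L j.Mn (L ^ j.k) j.k (rweight (d := d) L j.k) μ))
    (fun μ => tensorId ι (mPieces L j.Mn (L ^ j.k) j.k (rweight (d := d) L j.k) j.ν μ))
    (tensorId ι (pieceG L j.Mn (L ^ j.m * L ^ j.k) (j.k + j.m) (rweight (d := d) L j.k / ((L : ℝ) ^ j.m) ^ (d + 1))))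
    (tensorId ι (pieceS L j.Mn (L ^ j.m * L ^ j.k) (j.k + j.m) (rweight (d := d) L j.k / ((L : ℝ) ^ j.m) ^ (d + 1)) j.ν))
    (tensorId ι (pieceD3 L j.Mn (L ^ j.m * L ^ j.k) (j.k + j.m) (rweight (d := d) L j.k / ((L : ℝ) ^ j.m) ^ (d + 1))))
    (fun μ => tensorId ι (dPieces L j.Mn (L ^ j.m * L ^ j.k) (j.k + j.m) (rweight (d := d) L j.k / ((L : ℝ) ^ j.m) ^ (d + 1)) μ))
    (fun μ => tensorId ι (mPieces L j.Mn (L ^ j.m * L ^ j.k) (j.k + j.m) (rweight (d := d) L j.k / ((L : ℝ) ^ j.m) ^ (d + 1)) j.ν μ))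

variable {𝔄 ι L}

/-- **NE2⁺, OPERATOR LAYER — `T4EtaRate.NE2PlusOperator` BY NAME FOR THE U = 1 VECTOR PIECE ⊗ 1_𝔤 DRESSED BY THE (3.60)-SHAPED FULL PERTURBATION
`V′(A′) = V′₁(A′) − [F₂*aQ + Q*aF₂ + F₂*aF₂](A′)`, THE GAUGE FIELD `A′` THE DATUM.**  `d + 1 ≥ 2`, `L ≥ 1`, every `c₃₅ > 0`, every (3.24) weight `a`, and ANY
averaging-perturbation species — `F₂(A′)`, `F₂*(A′)` at both spacings, indexed by the family — carrying the six letters of `vecWord_letters` (`c_F ≥ 0`) for every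
index, every `α₀ > 0` with `2c₃₅Mα₀ ≤ 1` and every `Reg335 c₃₅ α₀`-regular `A′` (unit-scale C² letters): the realised gauge instances `v1GVecInstance` with the
families `vWGVecFamily4` satisfy `NE2PlusOperator c₃₅`.  Inside: `ne2PlusOperator_vWG` at `c_W = |a|c_F(2 + c_F)`; the `V′₁` inputs exactly as in
`ne2PlusOperator_vectorPiece_v1G` (twelve U ≡ 1 families of `uniform_layer_v1M`, step-connected fibres `C_π = 2(d+1)(L^m − 1)`); the word letters from
`vecWord_letters` (block mean concrete, uniform fibres `(L^m)^{d+1}`). [cite: Balaban1985BackgroundPropagators, Thm 3.1 p.397 (quantifier template), (3.35)–(3.36) p.396, (3.42) p.397, (3.44) p.398, (3.52) p.400, (3.59)–(3.65) pp.402–403 (shapes, mechanism); King1986, (4.42)–(4.43) p.675, p.664] -/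
theorem ne2PlusOperator_vectorPiece_vWordsG (hd : 1 ≤ d) (hL : 1 ≤ L) (c35 : ℝ) (hc35 : 0 < c35) {cF : ℝ} (hcF : 0 ≤ cF)
    (Fc : ∀ j : VecIndexS d L, (Fin (d + 1) → Tor (fine (L ^ j.m * L ^ j.k) j.Mn) × Fin (d + 1) → 𝔄) →
      (((Tor (fine (L ^ j.k) j.Mn) × Fin (d + 1)) × ι → ℝ) →ₗ[ℝ] ((Tor j.Mn × Fin (d + 1)) × ι → ℝ)))
    (Fsc : ∀ j : VecIndexS d L, (Fin (d + 1) → Tor (fine (L ^ j.m * L ^ j.k) j.Mn) × Fin (d + 1) → 𝔄) →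
      (((Tor j.Mn × Fin (d + 1)) × ι → ℝ) →ₗ[ℝ] ((Tor (fine (L ^ j.k) j.Mn) × Fin (d + 1)) × ι → ℝ)))
    (Ff : ∀ j : VecIndexS d L, (Fin (d + 1) → Tor (fine (L ^ j.m * L ^ j.k) j.Mn) × Fin (d + 1) → 𝔄) →
      (((Tor (fine (L ^ j.m * L ^ j.k) j.Mn) × Fin (d + 1)) × ι → ℝ) →ₗ[ℝ] ((Tor j.Mn × Fin (d + 1)) × ι → ℝ)))
    (Fsf : ∀ j : VecIndexS d L, (Fin (d + 1) → Tor (fine (L ^ j.m * L ^ j.k) j.Mn) × Fin (d + 1) → 𝔄) →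
      (((Tor j.Mn × Fin (d + 1)) × ι → ℝ) →ₗ[ℝ] ((Tor (fine (L ^ j.m * L ^ j.k) j.Mn) × Fin (d + 1)) × ι → ℝ)))
    (hF : ∀ (j : VecIndexS d L) (α₀ : ℝ) A', 0 < α₀ → 2 * (c35 * (j.Msz * α₀)) ≤ 1 → (v1GVecInstance (d := d) 𝔄 ι L hL j).Bf.Reg335 c35 α₀ A' →
      HasMaj (BlockNorm.ofBlocks (unitTorusGeoS L j.k j.Mn j.Msz) (liftBlk (blkFine L j.k j.Mn) ι))
        (BlockNorm.ofBlocks (unitTorusGeoS L j.k j.Mn j.Msz) (liftBlk (fun b : Tor j.Mn × Fin (d + 1) => b.1) ι)) (Fc j A')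
        (diagK fun _ => cF * (c35 * j.Msz * α₀)) ∧
      HasMaj (BlockNorm.ofBlocks (unitTorusGeoS L j.k j.Mn j.Msz) (liftBlk (fun b : Tor j.Mn × Fin (d + 1) => b.1) ι))
        (BlockNorm.ofBlocks (unitTorusGeoS L j.k j.Mn j.Msz) (liftBlk (blkFine L j.k j.Mn) ι)) (Fsc j A') (diagK fun _ => cF * (c35 * j.Msz * α₀)) ∧
      HasMaj (BlockNorm.ofBlocks (unitTorusGeoS L j.k j.Mn j.Msz) (liftBlk (blkFine L j.k j.Mn ∘ kingPrV L j.k j.m j.Mn) ι))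
        (BlockNorm.ofBlocks (unitTorusGeoS L j.k j.Mn j.Msz) (liftBlk (fun b : Tor j.Mn × Fin (d + 1) => b.1) ι)) (Ff j A')
        (diagK fun _ => cF * (c35 * j.Msz * α₀)) ∧
      HasMaj (BlockNorm.ofBlocks (unitTorusGeoS L j.k j.Mn j.Msz) (liftBlk (fun b : Tor j.Mn × Fin (d + 1) => b.1) ι))
        (BlockNorm.ofBlocks (unitTorusGeoS L j.k j.Mn j.Msz) (liftBlk (blkFine L j.k j.Mn ∘ kingPrV L j.k j.m j.Mn) ι)) (Fsf j A')
        (diagK fun _ => cF * (c35 * j.Msz * α₀)) ∧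
      HasMaj (BlockNorm.ofBlocks (unitTorusGeoS L j.k j.Mn j.Msz) (liftBlk (blkFine L j.k j.Mn) ι))
        (BlockNorm.ofBlocks (unitTorusGeoS L j.k j.Mn j.Msz) (liftBlk (fun b : Tor j.Mn × Fin (d + 1) => b.1) ι))
        (idef (pull (liftMap (kingPrV L j.k j.m j.Mn) ι)) LinearMap.id (Ff j A') (Fc j A')) (diagK fun _ => cF * (c35 * j.Msz * α₀) * thetaV L j) ∧
      HasMaj (BlockNorm.ofBlocks (unitTorusGeoS L j.k j.Mn j.Msz) (liftBlk (fun b : Tor j.Mn × Fin (d + 1) => b.1) ι))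
        (BlockNorm.ofBlocks (unitTorusGeoS L j.k j.Mn j.Msz) (liftBlk (blkFine L j.k j.Mn ∘ kingPrV L j.k j.m j.Mn) ι))
        (idef LinearMap.id (pull (liftMap (kingPrV L j.k j.m j.Mn) ι)) (Fsf j A') (Fsc j A')) (diagK fun _ => cF * (c35 * j.Msz * α₀) * thetaV L j)) :
    NE2PlusOperator c35 (v1GVecInstance (d := d) 𝔄 ι L hL) (vWGVecFamily4 (d := d) 𝔄 ι e L a hL Fc Fsc Ff Fsf) := by
  obtain ⟨β, δ, m₀, hβ, hδ, hm₀, H⟩ := uniform_layer_v1M (d := d) (ι := ι) (L := L) hd hL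
  have hL0 : L ≠ 0 := by omega
  have hLr : (0 : ℝ) < (L : ℝ) := by exact_mod_cast (show 0 < L by omega)
  have hL1 : (1 : ℝ) ≤ (L : ℝ) := by exact_mod_cast hL
  have hσ : 0 < δ / 2 := half_pos hδ
  have hd1 : (0 : ℝ) ≤ 2 * ((d : ℝ) + 1) := by positivity
  have hcW : 0 ≤ |a| * cF * (2 + cF) := by positivity
  -- `C_π(j)·η′_j = 2(d+1)(L^m − 1)·L^{−k}L^{−m} ≤ 2(d+1)·L^{−k} ≤ 2(d+1)·θ_j`
  have hCθ : ∀ j : VecIndexS d L, ((2 * ((d + 1) * (L ^ j.m - 1)) : ℕ) : ℝ) *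
      ((unitTorusGeoS L j.k j.Mn j.Msz).eta * ((unitTorusGeoS L j.k j.Mn j.Msz).L ^ j.m)⁻¹) ≤ 2 * ((d : ℝ) + 1) * thetaV L j := by
    intro j
    have hLm : (0 : ℝ) < (L : ℝ) ^ j.m := pow_pos hLr _
    have hLk : (0 : ℝ) < (L : ℝ) ^ j.k := pow_pos hLr _
    have hθ : ((L : ℝ) ^ j.k)⁻¹ ≤ thetaV L j := inv_pow_le_rpow hL j.k (by norm_num)
    have hsub : (((L ^ j.m - 1 : ℕ)) : ℝ) ≤ (L : ℝ) ^ j.m := by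
      have h1 : 1 ≤ L ^ j.m := Nat.one_le_pow _ _ (by omega)
      rw [Nat.cast_sub h1]; push_cast; linarith
    show ((2 * ((d + 1) * (L ^ j.m - 1)) : ℕ) : ℝ) * (((L : ℝ) ^ j.k)⁻¹ * ((L : ℝ) ^ j.m)⁻¹) ≤ 2 * ((d : ℝ) + 1) * thetaV L j
    have hcast : ((2 * ((d + 1) * (L ^ j.m - 1)) : ℕ) : ℝ) = 2 * ((d : ℝ) + 1) * (((L ^ j.m - 1 : ℕ)) : ℝ) := by push_cast; ring
    rw [hcast]
    calc 2 * ((d : ℝ) + 1) * (((L ^ j.m - 1 : ℕ)) : ℝ) * (((L : ℝ) ^ j.k)⁻¹ * ((L : ℝ) ^ j.m)⁻¹)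
        ≤ 2 * ((d : ℝ) + 1) * (L : ℝ) ^ j.m * (((L : ℝ) ^ j.k)⁻¹ * ((L : ℝ) ^ j.m)⁻¹) :=
          mul_le_mul_of_nonneg_right (mul_le_mul_of_nonneg_left hsub hd1) (by positivity)
      _ = 2 * ((d : ℝ) + 1) * ((L : ℝ) ^ j.k)⁻¹ := by field_simp
      _ ≤ 2 * ((d : ℝ) + 1) * thetaV L j := mul_le_mul_of_nonneg_left hθ hd1
  -- the word letters from the species letters
  have hW := fun (j : VecIndexS d L) (α₀ : ℝ) (A' : Fin (d + 1) → Tor (fine (L ^ j.m * L ^ j.k) j.Mn) × Fin (d + 1) → 𝔄) (hα₀ : 0 < α₀)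
      (hsm : 2 * (c35 * (j.Msz * α₀)) ≤ 1) (hreg : (v1GVecInstance (d := d) 𝔄 ι L hL j).Bf.Reg335 c35 α₀ A') =>
    vecWord_letters ι L a j hc35 hα₀ hcF hsm (hF j α₀ A' hα₀ hsm hreg).1 (hF j α₀ A' hα₀ hsm hreg).2.1 (hF j α₀ A' hα₀ hsm hreg).2.2.1
      (hF j α₀ A' hα₀ hsm hreg).2.2.2.1 (hF j α₀ A' hα₀ hsm hreg).2.2.2.2.1 (hF j α₀ A' hα₀ hsm hreg).2.2.2.2.2
  exact ne2PlusOperator_vWG e (I := VecIndexS d L) (J := Fin (d + 1)) (fun j => unitTorusGeoS L j.k j.Mn j.Msz)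
    (fun j => Tor (fine (L ^ j.k) j.Mn) × Fin (d + 1)) (fun j => Tor (fine (L ^ j.m * L ^ j.k) j.Mn) × Fin (d + 1))
    (fun j => blkFine L j.k j.Mn) (fun j => kingPrV L j.k j.m j.Mn) (fun j => j.m) (fun j => unitTorusGeoS_L_ne_zero L hL j) (thetaV L)
    (fun j => Sum.inl j.ν)
    (fun j => tensorId ι (pieceG L j.Mn (L ^ j.k) j.k (rweight (d := d) L j.k)))
    (fun j => tensorId ι (pieceS L j.Mn (L ^ j.k) j.k (rweight (d := d) L j.k) j.ν))
    (fun j => tensorId ι (pieceD3 L j.Mn (L ^ j.k) j.k (rweight (d := d) L j.k)))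
    (fun j μ => tensorId ι (dPieces L j.Mn (L ^ j.k) j.k (rweight (d := d) L j.k) μ))
    (fun j μ => tensorId ι (mPieces L j.Mn (L ^ j.k) j.k (rweight (d := d) L j.k) j.ν μ))
    (fun j => tensorId ι (pieceG L j.Mn (L ^ j.m * L ^ j.k) (j.k + j.m) (rweight (d := d) L j.k / ((L : ℝ) ^ j.m) ^ (d + 1))))
    (fun j => tensorId ι (pieceS L j.Mn (L ^ j.m * L ^ j.k) (j.k + j.m) (rweight (d := d) L j.k / ((L : ℝ) ^ j.m) ^ (d + 1)) j.ν))
    (fun j => tensorId ι (pieceD3 L j.Mn (L ^ j.m * L ^ j.k) (j.k + j.m) (rweight (d := d) L j.k / ((L : ℝ) ^ j.m) ^ (d + 1))))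
    (fun j μ => tensorId ι (dPieces L j.Mn (L ^ j.m * L ^ j.k) (j.k + j.m) (rweight (d := d) L j.k / ((L : ℝ) ^ j.m) ^ (d + 1)) μ))
    (fun j μ => tensorId ι (mPieces L j.Mn (L ^ j.m * L ^ j.k) (j.k + j.m) (rweight (d := d) L j.k / ((L : ℝ) ^ j.m) ^ (d + 1)) j.ν μ))
    (fun j κ => bshiftEquiv j.Mn (L ^ j.k) κ) (fun j κ => bshiftEquiv j.Mn (L ^ j.m * L ^ j.k) κ) (fun j => ((2 * ((d + 1) * (L ^ j.m - 1)) : ℕ) : ℝ))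
    c35 hc35 (fun j => vecWordC ι L a j (Fc j) (Fsc j)) (fun j => vecWordF ι L a j (Ff j) (Fsf j))
    (fun j => triangle254_unitTorusGeo L j.k j.Mn) (fun j a b => tdistT_nonneg _ _ _) hσ.le
    (B4Sect5Proof.latticeConst_nonneg (d + 1) hσ.le) (fun j => rowSum_unitTorusGeo L j.k j.Mn hσ)
    (fun j => inv_pos.mpr (pow_pos hLr _)) (fun j => inv_le_one_of_one_le₀ (one_le_pow₀ hL1)) (fun j => inv_pow_le_rpow hL j.k (by norm_num))
    (fun j => hL1) (fun j y => (unitTorusGeo_len L j.k j.Mn hL0 y).symm.le)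
    (by linarith) hβ.le hm₀.le (by norm_num : (0 : ℝ) < 1 / 4) (fun j y => le_rfl)
    (fun j μ κ x => bshiftEquiv_comm j.Mn (L ^ j.m * L ^ j.k) μ κ x) (fun j => Nat.cast_nonneg _)
    (fun j f b hf => fibre_conn_kingPrV L j.k j.m j.Mn f b hf) hd1 hCθ hcW
    (fun j α₀ A' hα₀ hsm hreg => (hW j α₀ A' hα₀ hsm hreg).1) (fun j α₀ A' hα₀ hsm hreg => (hW j α₀ A' hα₀ hsm hreg).2.1)
    (fun j α₀ A' hα₀ hsm hreg => (hW j α₀ A' hα₀ hsm hreg).2.2)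
    (fun j => (H j).1) (fun j => (H j).2.1) (fun j => (H j).2.2.1) (fun j => (H j).2.2.2.1) (fun j => (H j).2.2.2.2.1)
    (fun j => (H j).2.2.2.2.2.1) (fun j => (H j).2.2.2.2.2.2.1) (fun j => (H j).2.2.2.2.2.2.2.1) (fun j => (H j).2.2.2.2.2.2.2.2.1)
    (fun j => (H j).2.2.2.2.2.2.2.2.2.1) (fun j => (H j).2.2.2.2.2.2.2.2.2.2.1) (fun j => (H j).2.2.2.2.2.2.2.2.2.2.2)

/-- The four-dimensional instance (`d + 1 = 4`). [cite: Balaban1985BackgroundPropagators, Thm 3.1 p.397 (quantifier template)] -/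
theorem ne2PlusOperator_vectorPiece_vWordsG_dim4 (hL : 1 ≤ L) (c35 : ℝ) (hc35 : 0 < c35) {cF : ℝ} (hcF : 0 ≤ cF)
    (Fc : ∀ j : VecIndexS 3 L, (Fin 4 → Tor (fine (L ^ j.m * L ^ j.k) j.Mn) × Fin 4 → 𝔄) →
      (((Tor (fine (L ^ j.k) j.Mn) × Fin 4) × ι → ℝ) →ₗ[ℝ] ((Tor j.Mn × Fin 4) × ι → ℝ)))
    (Fsc : ∀ j : VecIndexS 3 L, (Fin 4 → Tor (fine (L ^ j.m * L ^ j.k) j.Mn) × Fin 4 → 𝔄) →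
      (((Tor j.Mn × Fin 4) × ι → ℝ) →ₗ[ℝ] ((Tor (fine (L ^ j.k) j.Mn) × Fin 4) × ι → ℝ)))
    (Ff : ∀ j : VecIndexS 3 L, (Fin 4 → Tor (fine (L ^ j.m * L ^ j.k) j.Mn) × Fin 4 → 𝔄) →
      (((Tor (fine (L ^ j.m * L ^ j.k) j.Mn) × Fin 4) × ι → ℝ) →ₗ[ℝ] ((Tor j.Mn × Fin 4) × ι → ℝ)))
    (Fsf : ∀ j : VecIndexS 3 L, (Fin 4 → Tor (fine (L ^ j.m * L ^ j.k) j.Mn) × Fin 4 → 𝔄) →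
      (((Tor j.Mn × Fin 4) × ι → ℝ) →ₗ[ℝ] ((Tor (fine (L ^ j.m * L ^ j.k) j.Mn) × Fin 4) × ι → ℝ)))
    (hF : ∀ (j : VecIndexS 3 L) (α₀ : ℝ) A', 0 < α₀ → 2 * (c35 * (j.Msz * α₀)) ≤ 1 → (v1GVecInstance (d := 3) 𝔄 ι L hL j).Bf.Reg335 c35 α₀ A' →
      HasMaj (BlockNorm.ofBlocks (unitTorusGeoS L j.k j.Mn j.Msz) (liftBlk (blkFine L j.k j.Mn) ι))
        (BlockNorm.ofBlocks (unitTorusGeoS L j.k j.Mn j.Msz) (liftBlk (fun b : Tor j.Mn × Fin 4 => b.1) ι)) (Fc j A')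
        (diagK fun _ => cF * (c35 * j.Msz * α₀)) ∧
      HasMaj (BlockNorm.ofBlocks (unitTorusGeoS L j.k j.Mn j.Msz) (liftBlk (fun b : Tor j.Mn × Fin 4 => b.1) ι))
        (BlockNorm.ofBlocks (unitTorusGeoS L j.k j.Mn j.Msz) (liftBlk (blkFine L j.k j.Mn) ι)) (Fsc j A') (diagK fun _ => cF * (c35 * j.Msz * α₀)) ∧
      HasMaj (BlockNorm.ofBlocks (unitTorusGeoS L j.k j.Mn j.Msz) (liftBlk (blkFine L j.k j.Mn ∘ kingPrV L j.k j.m j.Mn) ι))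
        (BlockNorm.ofBlocks (unitTorusGeoS L j.k j.Mn j.Msz) (liftBlk (fun b : Tor j.Mn × Fin 4 => b.1) ι)) (Ff j A')
        (diagK fun _ => cF * (c35 * j.Msz * α₀)) ∧
      HasMaj (BlockNorm.ofBlocks (unitTorusGeoS L j.k j.Mn j.Msz) (liftBlk (fun b : Tor j.Mn × Fin 4 => b.1) ι))
        (BlockNorm.ofBlocks (unitTorusGeoS L j.k j.Mn j.Msz) (liftBlk (blkFine L j.k j.Mn ∘ kingPrV L j.k j.m j.Mn) ι)) (Fsf j A')
        (diagK fun _ => cF * (c35 * j.Msz * α₀)) ∧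
      HasMaj (BlockNorm.ofBlocks (unitTorusGeoS L j.k j.Mn j.Msz) (liftBlk (blkFine L j.k j.Mn) ι))
        (BlockNorm.ofBlocks (unitTorusGeoS L j.k j.Mn j.Msz) (liftBlk (fun b : Tor j.Mn × Fin 4 => b.1) ι))
        (idef (pull (liftMap (kingPrV L j.k j.m j.Mn) ι)) LinearMap.id (Ff j A') (Fc j A')) (diagK fun _ => cF * (c35 * j.Msz * α₀) * thetaV L j) ∧
      HasMaj (BlockNorm.ofBlocks (unitTorusGeoS L j.k j.Mn j.Msz) (liftBlk (fun b : Tor j.Mn × Fin 4 => b.1) ι))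
        (BlockNorm.ofBlocks (unitTorusGeoS L j.k j.Mn j.Msz) (liftBlk (blkFine L j.k j.Mn ∘ kingPrV L j.k j.m j.Mn) ι))
        (idef LinearMap.id (pull (liftMap (kingPrV L j.k j.m j.Mn) ι)) (Fsf j A') (Fsc j A')) (diagK fun _ => cF * (c35 * j.Msz * α₀) * thetaV L j)) :
    NE2PlusOperator c35 (v1GVecInstance (d := 3) 𝔄 ι L hL) (vWGVecFamily4 (d := 3) 𝔄 ι e L a hL Fc Fsc Ff Fsf) :=
  ne2PlusOperator_vectorPiece_vWordsG (d := 3) e a (by norm_num) hL c35 hc35 hcF Fc Fsc Ff Fsf hF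

/-- **NE2⁰ FOR THE SAME FAMILY — `T4EtaRate.NE2ZeroOperator` BY NAME**: the trivial gauge field `A′ = 0` (the carrier's `one`) satisfies the C² letters for every
`α₀ > 0` (`M ≥ 1`), so `T4EtaRate.ne2Zero_of_ne2Plus` applies at `c₃₅ = 1` (the species letters are asked at `c₃₅ = 1`). [cite: King1986, Props. 3.8–3.9 (3.71)–(3.75) pp.664–665 (A = 0 model); Balaban1985BackgroundPropagators, Thm 3.1 p.397 (quantifier template)] -/
theorem ne2ZeroOperator_vectorPiece_vWordsG (hd : 1 ≤ d) (hL : 1 ≤ L) {cF : ℝ} (hcF : 0 ≤ cF)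
    (Fc : ∀ j : VecIndexS d L, (Fin (d + 1) → Tor (fine (L ^ j.m * L ^ j.k) j.Mn) × Fin (d + 1) → 𝔄) →
      (((Tor (fine (L ^ j.k) j.Mn) × Fin (d + 1)) × ι → ℝ) →ₗ[ℝ] ((Tor j.Mn × Fin (d + 1)) × ι → ℝ)))
    (Fsc : ∀ j : VecIndexS d L, (Fin (d + 1) → Tor (fine (L ^ j.m * L ^ j.k) j.Mn) × Fin (d + 1) → 𝔄) →
      (((Tor j.Mn × Fin (d + 1)) × ι → ℝ) →ₗ[ℝ] ((Tor (fine (L ^ j.k) j.Mn) × Fin (d + 1)) × ι → ℝ)))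
    (Ff : ∀ j : VecIndexS d L, (Fin (d + 1) → Tor (fine (L ^ j.m * L ^ j.k) j.Mn) × Fin (d + 1) → 𝔄) →
      (((Tor (fine (L ^ j.m * L ^ j.k) j.Mn) × Fin (d + 1)) × ι → ℝ) →ₗ[ℝ] ((Tor j.Mn × Fin (d + 1)) × ι → ℝ)))
    (Fsf : ∀ j : VecIndexS d L, (Fin (d + 1) → Tor (fine (L ^ j.m * L ^ j.k) j.Mn) × Fin (d + 1) → 𝔄) →
      (((Tor j.Mn × Fin (d + 1)) × ι → ℝ) →ₗ[ℝ] ((Tor (fine (L ^ j.m * L ^ j.k) j.Mn) × Fin (d + 1)) × ι → ℝ)))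
    (hF : ∀ (j : VecIndexS d L) (α₀ : ℝ) A', 0 < α₀ → 2 * (1 * (j.Msz * α₀)) ≤ 1 → (v1GVecInstance (d := d) 𝔄 ι L hL j).Bf.Reg335 1 α₀ A' →
      HasMaj (BlockNorm.ofBlocks (unitTorusGeoS L j.k j.Mn j.Msz) (liftBlk (blkFine L j.k j.Mn) ι))
        (BlockNorm.ofBlocks (unitTorusGeoS L j.k j.Mn j.Msz) (liftBlk (fun b : Tor j.Mn × Fin (d + 1) => b.1) ι)) (Fc j A')
        (diagK fun _ => cF * (1 * j.Msz * α₀)) ∧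
      HasMaj (BlockNorm.ofBlocks (unitTorusGeoS L j.k j.Mn j.Msz) (liftBlk (fun b : Tor j.Mn × Fin (d + 1) => b.1) ι))
        (BlockNorm.ofBlocks (unitTorusGeoS L j.k j.Mn j.Msz) (liftBlk (blkFine L j.k j.Mn) ι)) (Fsc j A') (diagK fun _ => cF * (1 * j.Msz * α₀)) ∧
      HasMaj (BlockNorm.ofBlocks (unitTorusGeoS L j.k j.Mn j.Msz) (liftBlk (blkFine L j.k j.Mn ∘ kingPrV L j.k j.m j.Mn) ι))
        (BlockNorm.ofBlocks (unitTorusGeoS L j.k j.Mn j.Msz) (liftBlk (fun b : Tor j.Mn × Fin (d + 1) => b.1) ι)) (Ff j A')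
        (diagK fun _ => cF * (1 * j.Msz * α₀)) ∧
      HasMaj (BlockNorm.ofBlocks (unitTorusGeoS L j.k j.Mn j.Msz) (liftBlk (fun b : Tor j.Mn × Fin (d + 1) => b.1) ι))
        (BlockNorm.ofBlocks (unitTorusGeoS L j.k j.Mn j.Msz) (liftBlk (blkFine L j.k j.Mn ∘ kingPrV L j.k j.m j.Mn) ι)) (Fsf j A')
        (diagK fun _ => cF * (1 * j.Msz * α₀)) ∧
      HasMaj (BlockNorm.ofBlocks (unitTorusGeoS L j.k j.Mn j.Msz) (liftBlk (blkFine L j.k j.Mn) ι))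
        (BlockNorm.ofBlocks (unitTorusGeoS L j.k j.Mn j.Msz) (liftBlk (fun b : Tor j.Mn × Fin (d + 1) => b.1) ι))
        (idef (pull (liftMap (kingPrV L j.k j.m j.Mn) ι)) LinearMap.id (Ff j A') (Fc j A')) (diagK fun _ => cF * (1 * j.Msz * α₀) * thetaV L j) ∧
      HasMaj (BlockNorm.ofBlocks (unitTorusGeoS L j.k j.Mn j.Msz) (liftBlk (fun b : Tor j.Mn × Fin (d + 1) => b.1) ι))
        (BlockNorm.ofBlocks (unitTorusGeoS L j.k j.Mn j.Msz) (liftBlk (blkFine L j.k j.Mn ∘ kingPrV L j.k j.m j.Mn) ι))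
        (idef LinearMap.id (pull (liftMap (kingPrV L j.k j.m j.Mn) ι)) (Fsf j A') (Fsc j A')) (diagK fun _ => cF * (1 * j.Msz * α₀) * thetaV L j)) :
    NE2ZeroOperator (v1GVecInstance (d := d) 𝔄 ι L hL) (vWGVecFamily4 (d := d) 𝔄 ι e L a hL Fc Fsc Ff Fsf) := by
  refine ne2Zero_of_ne2Plus (c35 := 1) (fun j α₀ hα₀ => ?_) (ne2PlusOperator_vectorPiece_vWordsG (d := d) e a hd hL 1 one_pos hcF Fc Fsc Ff Fsf hF)
  have hM : 0 ≤ (1 : ℝ) * j.Msz * α₀ := by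
    have h1 : (0 : ℝ) ≤ j.Msz := zero_le_one.trans j.one_le_Msz
    positivity
  have hLr : (0 : ℝ) ≤ (L : ℝ) := Nat.cast_nonneg L
  have hη : 0 ≤ ((L : ℝ) ^ j.k)⁻¹ * ((L : ℝ) ^ j.m)⁻¹ := mul_nonneg (inv_nonneg.2 (pow_nonneg hLr _)) (inv_nonneg.2 (pow_nonneg hLr _))
  refine ⟨fun μ x' => ?_, fun μ κ x' => ?_, fun μ κ x' => ?_⟩
  · show ‖(0 : 𝔄)‖ ≤ 1 * j.Msz * α₀
    rw [norm_zero]; exact hM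
  · show ‖(0 : 𝔄) - 0‖ ≤ 1 * j.Msz * α₀ * (((L : ℝ) ^ j.k)⁻¹ * ((L : ℝ) ^ j.m)⁻¹)
    rw [sub_zero, norm_zero]; exact mul_nonneg hM hη
  · show ‖(0 : 𝔄) - 0 - (0 - 0)‖ ≤ 1 * j.Msz * α₀ * (((L : ℝ) ^ j.k)⁻¹ * ((L : ℝ) ^ j.m)⁻¹) * (((L : ℝ) ^ j.k)⁻¹ * ((L : ℝ) ^ j.m)⁻¹)
    rw [show (0 : 𝔄) - 0 - (0 - 0) = 0 by simp, norm_zero]; exact mul_nonneg (mul_nonneg hM hη) hη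

end Knit

end Summit.QuantumFields.YangMills.BalabanUVNodes.N15.VectorPiece

end
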